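import Literature.AlgebraicGeometry.HodgeTheory.CyclicCoverPencilModelIsotopyProps
import Literature.AlgebraicGeometry.HodgeTheory.CyclicCoverPencilSaturatedRadius
import HarnessLib

/-!
# The model isotopy of the nodal pencil: the good set

Family `hodge`, layer `Literature/AlgebraicGeometry/HodgeTheory`; step A3b (sixth part). The points `x ∈ 𝒴°(ℂ)` with remaining coefficients `b'₀`,
small saturated radius `F(x) < R₀` (`R₀ ≤ R'''`, `R₀ ≤ r²`) and pencil coordinate `0 < |c(x)| < ρW` lie in the chart source with affine
coordinates in the Morse chart ball, and ALL their rotated coordinate vectors lie in the chart target (`chartModelIsotopy_nodal_spec`) — i.e. they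
belong to the set `G` on which `CyclicCoverPencilModelIsotopyContinuity.continuousOn_chartModelIsotopy` gives joint continuity.

* `mem_goodSet_of_satRadius_lt`.

Everything is proved; no definitions, no named facts.

## References

* [Milnor1968] J. Milnor, Singular Points of Complex Hypersurfaces (1968), §9 Lemma 9.4.
-/

noncomputable section

open MvPolynomial Set Function Complex
open Literature.AlgebraicGeometry.Motives Literature.AlgebraicGeometry.Motives.UniversalHypersurface
open Literature.AlgebraicGeometry.HodgeTheory.UniversalHypersurface Literature.Geometry.ComplexAnalytic

namespace Literature.AlgebraicGeometry.HodgeTheory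

/-- **Good points lie in the continuity set of the model isotopy.** [cite: Milnor1968, §9 Lemma 9.4] -/
theorem mem_goodSet_of_satRadius_lt {p : ℕ} (hp : 3 ≤ p)
    (Φ : OpenPartialHomeomorph (ComplexPoints (regularTotal ℂ 2 p)) (({m : DegIndex 2 p // m ≠ regPowIndex 2 p 2} ⊕ Fin (2 + 1)) → ℂ))
    (hΦ : ⇑Φ = regChartFun 2 p 2) (hΦs : Φ.source = regChartDom 2 p 2) (hΦt : Φ.target = regChartFun 2 p 2 '' regChartDom 2 p 2)
    (Θ : OpenPartialHomeomorph (Fin (1 + 2) → ℂ) (Fin (1 + 2) → ℂ)) {r R₀ R''' R'' : ℝ}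
    (hr : {z : Fin (1 + 2) → ℂ | ∑ i, ‖z i‖ ^ 2 ≤ r ^ 2} ⊆ Θ.target)
    (hΘφ : ∀ x ∈ Θ.source, ∑ i, (Θ x) i ^ PhamBrieskorn.cyclicNodeExponents p i = x 2 ^ p - (x 0 * x 1 + x 0 ^ p + x 1 ^ p))
    {ρW : ℝ}
    (hns : ∀ c : ℂ, c ≠ 0 → ‖c‖ < ρW → SmoothHypersurface.IsNonsingularForm ℂ (formOfCoeffs
      (coeffsOf 2 p (cyclicCoverForm p (X 2 ^ (p - 2) * (X 0 * X 1) + X 0 ^ p + X 1 ^ p)) - Pi.single (regPowIndex 2 p 2) c)))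
    (hR : R''' < R'') (hR₀ : R₀ ≤ R''') (hR₀r : R₀ ≤ r ^ 2)
    {x : ComplexPoints (regularTotal ℂ 2 p)}
    (hb : ∀ m : {m : DegIndex 2 p // m ≠ regPowIndex 2 p 2},
      regCoeff ℂ 2 p x m.1 = coeffsOf 2 p (cyclicCoverForm p (X 2 ^ (p - 2) * (X 0 * X 1) + X 0 ^ p + X 1 ^ p)) m.1)
    (hF : satRadius p Θ R''' R'' x < R₀) (hc0 : pencilCoord p x ≠ 0) (hcρ : ‖pencilCoord p x‖ < ρW) :
    x ∈ Φ.source ∧ (fun j => Φ x (Sum.inr j)) ∈ Θ.source ∧ ∑ k, ‖Θ (fun j => Φ x (Sum.inr j)) k‖ ^ 2 < r ^ 2 ∧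
      ∀ θ : ℝ, (Sum.elim (fun m => Φ x (Sum.inl m))
        (Θ.symm (fun k => Complex.exp (((θ / PhamBrieskorn.cyclicNodeExponents p k : ℝ) : ℂ) * I) *
          Θ (fun j => Φ x (Sum.inr j)) k)) :
            ({m : DegIndex 2 p // m ≠ regPowIndex 2 p 2} ⊕ Fin (2 + 1)) → ℂ) ∈ Φ.target := by
  obtain ⟨hxd, hy, hSig⟩ := mem_of_satRadius_lt p Θ R''' R'' hR (lt_of_lt_of_le hF hR₀)
  have hx : x ∈ Φ.source := hΦs ▸ hxd
  have hyr : ∑ i, ‖Θ (fun j => regChartFun 2 p 2 x (Sum.inr j)) i‖ ^ 2 < r ^ 2 := by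
    rw [hSig]; exact lt_of_lt_of_le hF hR₀r
  refine ⟨hx, by rw [hΦ]; exact hy, by rw [hΦ]; exact hyr, fun θ => ?_⟩
  obtain ⟨hJs, hJ⟩ := chartModelIsotopy_nodal_spec hp Φ hΦ hΦs hΦt Θ hr hΘφ hns hx hb hy hyr hc0 hcρ θ
  rw [← hJ]
  exact Φ.map_source hJs

end Literature.AlgebraicGeometry.HodgeTheory

end
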